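import Summits.HubbardSuperconductivity.HubbardLadder.Bounds.TwistInsensitivityHolder
import HarnessLib

/-!
# The Hölder-constant activity bound at COMPLEX fugacity:
# `|couplingWeight β U μ c K| ≤ ∏_{b∈K} (e^{|c_b|} - 1) · r^{|supp K|}`, `r = siteRatio β U μ`

HONEST FRAMING (cell pub-hubbard): ladder R1–R4 with certified numbers; no claim on H/H₀. Bounds for
model classes (activities of the polymer expansion of Hubbard-type lattice fermions with COMPLEX
on-site parameters — in particular a complex chemical potential, i.e. a complex fugacity — and
arbitrary complex bond couplings), no materials claim. Imports only landed modules
(`EulerActivityBound` #198.2, `TwistInsensitivityHolder` #198.4 and their tree).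

THEOREM (`norm_couplingWeight_le_prod_exp_sub_one_mul_siteRatio_pow`). For complex `β, U, μ` with
`z₀(β,U,μ) ≠ 0`, any complex couplings `c` and any bond set `K`:

  `|couplingWeight β U μ c K| ≤ (∏_{b ∈ K} (e^{|c_b|} - 1)) · r^{|supp K|}`,
  `r = siteRatio β U μ = z₀(1, Re βU, Re βμ) / |z₀(β,U,μ)| ≥ 1` (`one_le_siteRatio`).

This is the complex-fugacity form of #198.2's `norm_couplingWeight_le_prod_exp_sub_one` (real
`β, U, μ`, `r = 1`): bounds.tex Lemma 13.1 (b) — at fugacity `ζ = s + iφ` the polymer activities of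
the Hubbard gas obey the Hölder bound of Lemma 12.2 up to the factor `(z(s)/|z(ζ)|)^{|supp|}`. The
proof is #198.2's Euler–Trotter domination with ONE change: the Euler factor `e^{D/N}` of the complex
diagonal `D = -βV_A` is `diag(e^{Re d/N}) · diag(e^{i Im d/N})`, and the unitary diagonal is absorbed
into the letters (it preserves substochastic moduli, `absEntry_diagonal_mul_of_norm_eq_one`), so the
AM–GM word bound of #198.1 gives `|Tr word| ≤ Σ_s e^{Re d_s} = z₀(1, Re βU, Re βμ)^{|A|} 4^{|Λ|-|A|}`
(`norm_trace_listProd_diagCexp_mul_le`, `norm_alternatingSum_eulerTrace_le_complex`), while the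
normalisation is `|Tr e^{-βV_A}| = |z₀|^{|A|} 4^{|Λ|-|A|}` after localising to `A = supp K`
(`gibbsRatio_eq_div`).

COROLLARY (`sum_norm_couplingActivity_mul_exp_le_catalan_exp_siteRatio`): the one-site
Kotecký–Preiss smallness in the Catalan × Hölder form of #198.4 with the site ratio:
if `|c_b| ≤ δ_b` on `D`, `Σ_{b ∈ D, v ∈ b} (e^{δ_b} - 1) ≤ W` at every site, `a ≥ 0` and
`r e^{a} + W F² ≤ F`, then `Σ_{A ∋ x} |couplingActivity D β U μ c A| e^{a|A|} ≤ F - r e^{a}`.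
This is the input of the arc estimate (Lemma 13.1 (e)) and of the off-arc volume lemma (Lemma 13.2)
of the canonical-ensemble theorem (bounds.tex §13) at complex fugacity.

References: D. Ueltschi, J. Stat. Phys. 95 (1999) 693, §2.3 [Ueltschi1999] (the factor
`‖e^{-βV}‖^{|𝒜|} e^{βf₀|𝒜|}` for complex parameters); R. Kotecký, D. Preiss, Comm. Math. Phys. 103
(1986) 491 [KoteckyPreiss1986]; bounds.tex §13 Lemma 13.1 (b).
-/

namespace Summit.HubbardSuperconductivity.HubbardLadder.Bounds

open Matrix Finset Filter Topology
open Literature.MathematicalPhysics.QuantumLattice Literature.Probability.LatticeModels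

/-! ### Domination at finite `N` with a complex diagonal (generic) -/

section Domination

variable {n : Type*} [Fintype n] [DecidableEq n] {α : Type*} [Fintype α] [DecidableEq α]

/-- A diagonal of unit-modulus phases preserves the entrywise moduli: `|diag(φ) X| = |X|`.
[folklore] -/
theorem absEntry_diagonal_mul_of_norm_eq_one {φ : n → ℂ} (hφ : ∀ s, ‖φ s‖ = 1) (X : Matrix n n ℂ) :
    absEntry (diagonal φ * X) = absEntry X := by
  ext s t
  simp only [absEntry_apply, diagonal_mul, norm_mul, hφ, one_mul]

/-- `e^{z/N} = e^{Re z/N} · e^{i Im z/N}`. [folklore] -/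
theorem cexp_div_natCast_eq (z : ℂ) (N : ℕ) :
    Complex.exp (z / N) = (Real.exp (z.re / N) : ℂ) * Complex.exp (((z.im / N : ℝ) : ℂ) * Complex.I) := by
  rw [Complex.ofReal_exp, ← Complex.exp_add]
  congr 1
  rw [← Complex.re_add_im (z / N), Complex.div_natCast_re, Complex.div_natCast_im]

/-- **The AM–GM word bound with a complex diagonal.** For complex `d`, `N ≥ 1` and complex matrices
`X₀, …, X_{N-1}` with substochastic moduli, `|Tr ∏_k (diag(e^{d/N}) X_k)| ≤ Σ_s e^{Re d_s}`: the
phases `diag(e^{i Im d/N})` are absorbed into the letters and #198.1's real bound applies.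
[folklore; this file] -/
theorem norm_trace_listProd_diagCexp_mul_le {N : ℕ} (hN : N ≠ 0) (d : n → ℂ)
    (X : Fin N → Matrix n n ℂ) (hX : ∀ k, absEntry (X k) ∈ subStoch) :
    ‖((List.ofFn fun k => diagonal (fun s => Complex.exp (d s / N)) * X k).prod).trace‖ ≤
      ∑ s, Real.exp ((d s).re) := by
  set φ : n → ℂ := fun s => Complex.exp ((((d s).im / N : ℝ) : ℂ) * Complex.I) with hφ
  have hφ1 : ∀ s, ‖φ s‖ = 1 := fun s => by
    simp only [hφ, Complex.norm_exp_ofReal_mul_I]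
  have hsplit : (fun k => diagonal (fun s => Complex.exp (d s / N)) * X k) =
      fun k => diagonal (fun s => (Real.exp ((fun s => (d s).re) s / N) : ℂ)) * (diagonal φ * X k) := by
    funext k
    rw [← Matrix.mul_assoc, diagonal_mul_diagonal]
    congr 2
    funext s
    exact cexp_div_natCast_eq (d s) N
  rw [hsplit]
  refine norm_trace_listProd_diagExp_mul_le hN (fun s => (d s).re) (fun k => diagonal φ * X k) ?_
  intro k
  rw [absEntry_diagonal_mul_of_norm_eq_one hφ1]
  exact hX k

/-- **Domination at finite `N`, complex diagonal.** For complex `d`, `N ≥ 1`, bond matrices `B_b`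
with substochastic moduli and complex `c`:
`|Σ_{Y⊆K} (-1)^{|K∖Y|} Tr (diag(e^{d/N})(1 + N⁻¹ Σ_{b∈Y} c_b B_b))^N| ≤ ∏_{b∈K}(e^{|c_b|}-1) · Σ_s e^{Re d_s}`.
Verbatim #198.2's `norm_alternatingSum_eulerTrace_le` with the complex word bound.
[folklore; this file] -/
theorem norm_alternatingSum_eulerTrace_le_complex {N : ℕ} (hN : N ≠ 0) (d : n → ℂ)
    {B : α → Matrix n n ℂ} (hB : ∀ b, absEntry (B b) ∈ subStoch) (c : α → ℂ) (K : Finset α) :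
    ‖∑ Y ∈ K.powerset, (-1 : ℂ) ^ (K \ Y).card *
        ((diagonal (fun s => Complex.exp (d s / N)) * (1 + (N : ℂ)⁻¹ • ∑ b ∈ Y, c b • B b)) ^ N).trace‖
      ≤ (∏ b ∈ K, (Real.exp ‖c b‖ - 1)) * ∑ s, Real.exp ((d s).re) := by
  set E : Matrix n n ℂ := diagonal (fun s => Complex.exp (d s / N)) with hE
  set W : (Fin N → Option α) → Matrix n n ℂ :=
    fun f => (List.ofFn fun k => E * letterMat B (f k)).prod with hW
  -- step 1: each trace as a sum over words
  have h1 : ∀ Y : Finset α, ((E * (1 + (N : ℂ)⁻¹ • ∑ b ∈ Y, c b • B b)) ^ N).trace =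
      ∑ f : Fin N → Option α,
        (if usedSet f ⊆ Y then ∏ k, letterCoef0 c N (f k) else 0) * (W f).trace := by
    intro Y
    rw [euler_factor_eq_sum, ← List.prod_replicate, ← List.ofFn_const,
      listProd_ofFn_sum_smul N (fun _ => letterCoef c N Y) (fun _ a => E * letterMat B a),
      Matrix.trace_sum]
    refine Finset.sum_congr rfl fun f _ => ?_
    rw [Matrix.trace_smul, smul_eq_mul, prod_letterCoef_eq]
  -- step 2: Möbius inversion keeps the covering words
  have h2 : ∑ Y ∈ K.powerset, (-1 : ℂ) ^ (K \ Y).card *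
        ((E * (1 + (N : ℂ)⁻¹ • ∑ b ∈ Y, c b • B b)) ^ N).trace =
      ∑ f : Fin N → Option α,
        (if usedSet f = K then (1 : ℂ) else 0) * ((∏ k, letterCoef0 c N (f k)) * (W f).trace) := by
    rw [Finset.sum_congr rfl fun Y _ => by rw [h1 Y, Finset.mul_sum], Finset.sum_comm]
    refine Finset.sum_congr rfl fun f _ => ?_
    rw [← sum_powerset_neg_one_pow_card_sdiff_ite_subset (usedSet f) K, Finset.sum_mul]
    refine Finset.sum_congr rfl fun Y _ => ?_
    split_ifs <;> ring
  rw [h2]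
  -- step 3: norms, with the complex word bound
  have hZ : ∀ f : Fin N → Option α, ‖(W f).trace‖ ≤ ∑ s, Real.exp ((d s).re) := fun f =>
    norm_trace_listProd_diagCexp_mul_le hN d (fun k => letterMat B (f k))
      fun k => absEntry_letterMat_mem_subStoch hB (f k)
  have hx0 : ∀ f : Fin N → Option α,
      ‖∏ k, letterCoef0 c N (f k)‖ = ∏ k, letterWt (fun b => ‖c b‖ / N) (f k) := fun f => by
    rw [norm_prod]
    exact Finset.prod_congr rfl fun k _ => norm_letterCoef0 c N (f k)
  have hy : ∀ b, 0 ≤ ‖c b‖ / N := fun b => by positivity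
  have hZ0 : 0 ≤ ∑ s, Real.exp ((d s).re) := Finset.sum_nonneg fun s _ => (Real.exp_pos _).le
  calc ‖∑ f : Fin N → Option α,
          (if usedSet f = K then (1 : ℂ) else 0) * ((∏ k, letterCoef0 c N (f k)) * (W f).trace)‖
      ≤ ∑ f : Fin N → Option α,
          ‖(if usedSet f = K then (1 : ℂ) else 0) * ((∏ k, letterCoef0 c N (f k)) * (W f).trace)‖ :=
        norm_sum_le _ _
    _ ≤ ∑ f : Fin N → Option α,
          (if usedSet f = K then ∏ k, letterWt (fun b => ‖c b‖ / N) (f k) else 0) *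
            ∑ s, Real.exp ((d s).re) := by
        refine Finset.sum_le_sum fun f _ => ?_
        split_ifs with hf
        · rw [one_mul, norm_mul, hx0 f]
          exact mul_le_mul_of_nonneg_left (hZ f) (Finset.prod_nonneg fun k _ => letterWt_nonneg hy _)
        · simp
    _ = coverSum (fun b => ‖c b‖ / N) N K * ∑ s, Real.exp ((d s).re) := by
        rw [coverSum, Finset.sum_mul]
    _ ≤ (∏ b ∈ K, (Real.exp (N * (‖c b‖ / N)) - 1)) * ∑ s, Real.exp ((d s).re) :=
        mul_le_mul_of_nonneg_right (coverSum_le hy N K) hZ0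
    _ = (∏ b ∈ K, (Real.exp ‖c b‖ - 1)) * ∑ s, Real.exp ((d s).re) := by
        congr 1
        refine Finset.prod_congr rfl fun b _ => ?_
        rw [mul_div_cancel₀ _ (by exact_mod_cast hN : (N : ℝ) ≠ 0)]

end Domination

/-! ### Application to the Hubbard coupling weights at complex on-site parameters -/

section Hubbard

variable {Λ : Type*} [LinearOrder Λ] [Fintype Λ]

/-- `-β V_A(U, μ)` is the complex diagonal matrix `diag(-onSiteDiag (βU) (βμ) A)`. [folklore] -/
theorem neg_smul_onSiteSum_eq_diagonal_complex (β U μ : ℂ) (A : Finset Λ) :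
    -(β • onSiteSum U μ A) =
      diagonal fun s : Finset (Orb Λ) => -onSiteDiag (β * U) (β * μ) A s := by
  rw [smul_onSiteSum_eq_diagonal, ← diagonal_neg]

/-- Exponential of `N⁻¹` times a complex diagonal matrix. [folklore] -/
theorem exp_inv_smul_diagonal_complex (d : Finset (Orb Λ) → ℂ) (N : ℕ) :
    NormedSpace.exp ((N : ℂ)⁻¹ • diagonal d) = diagonal fun s => Complex.exp (d s / N) := by
  rw [← diagonal_smul, Matrix.exp_diagonal]
  congr 1
  funext s
  rw [Pi.exp_def, ← Complex.exp_eq_exp_ℂ]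
  simp only [Pi.smul_apply, smul_eq_mul]
  rw [div_eq_inv_mul]

/-- **The real-part trace**: `Σ_s e^{Re(-β v_A(s))} = z₀(1, Re βU, Re βμ)^{|A|} · 4^{|Λ|-|A|}`
(the on-site operator with the real parts of the coefficients, `trace_exp_neg_onSiteSum`).
[cite: Ueltschi1999, §2.3 (‖e^{-βV_x}‖ = e^{-βe₀})] -/
theorem sum_exp_re_neg_onSiteDiag (β U μ : ℂ) (A : Finset Λ) :
    ∑ s : Finset (Orb Λ), Real.exp ((-onSiteDiag (β * U) (β * μ) A s).re) =
      atomicPartitionFnReal 1 (β * U).re (β * μ).re ^ A.card * 4 ^ (Fintype.card Λ - A.card) := by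
  have hC : ((∑ s : Finset (Orb Λ), Real.exp ((-onSiteDiag (β * U) (β * μ) A s).re) : ℝ) : ℂ) =
      (NormedSpace.exp (-((1 : ℂ) • onSiteSum ((β * U).re : ℂ) ((β * μ).re : ℂ) A))).trace := by
    rw [neg_smul_onSiteSum_eq_diagonal_complex, one_mul, one_mul, Matrix.exp_diagonal, trace_diagonal,
      Complex.ofReal_sum]
    refine Finset.sum_congr rfl fun s _ => ?_
    rw [Pi.exp_def, ← Complex.exp_eq_exp_ℂ, Complex.ofReal_exp]
    congr 1
    rw [Complex.neg_re, Complex.ofReal_neg, onSiteDiag_re]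
  have h := trace_exp_neg_onSiteSum (1 : ℂ) ((β * U).re : ℂ) ((β * μ).re : ℂ) A
  rw [← Complex.ofReal_one, atomicPartitionFn_ofReal, Complex.ofReal_one] at h
  rw [h] at hC
  exact_mod_cast hC

/-- **`r = siteRatio β U μ ≥ 1`** when `z₀ ≠ 0`: `|z₀(β,U,μ)| ≤ z₀(1, Re βU, Re βμ)` by the triangle
inequality. [folklore] -/
theorem one_le_siteRatio {β U μ : ℂ} (hz : atomicPartitionFn β U μ ≠ 0) : 1 ≤ siteRatio β U μ := by
  unfold siteRatio
  rw [one_le_div (norm_pos_iff.2 hz)]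
  unfold atomicPartitionFn atomicPartitionFnReal
  simp only [one_mul]
  have h1 : ‖(2 : ℂ) * Complex.exp (β * μ)‖ = 2 * Real.exp ((β * μ).re) := by
    rw [norm_mul, Complex.norm_exp, Complex.norm_two]
  have hre : (-(β * (U - 2 * μ))).re = -((β * U).re - 2 * (β * μ).re) := by
    rw [show β * (U - 2 * μ) = β * U - ((2 : ℝ) : ℂ) * (β * μ) by push_cast; ring, Complex.neg_re,
      Complex.sub_re, Complex.re_ofReal_mul]
  have h2 : ‖Complex.exp (-(β * (U - 2 * μ)))‖ = Real.exp (-((β * U).re - 2 * (β * μ).re)) := by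
    rw [Complex.norm_exp, hre]
  calc ‖1 + 2 * Complex.exp (β * μ) + Complex.exp (-(β * (U - 2 * μ)))‖
      ≤ ‖(1 : ℂ)‖ + ‖2 * Complex.exp (β * μ)‖ + ‖Complex.exp (-(β * (U - 2 * μ)))‖ :=
        norm_add₃_le
    _ = 1 + 2 * Real.exp ((β * μ).re) + Real.exp (-((β * U).re - 2 * (β * μ).re)) := by
        rw [h1, h2, norm_one]

/-- **THEOREM (the Hölder-constant activity bound at complex fugacity).** For complex `β, U, μ`
with `z₀(β,U,μ) ≠ 0`, complex couplings `c` and a bond set `K`: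
`|couplingWeight β U μ c K| ≤ ∏_{b∈K} (e^{|c_b|} - 1) · r^{|supp K|}`, `r = siteRatio β U μ`.
[programme: bounds.tex §13 Lemma 13.1 (b); the constant of Ueltschi1999 §2.3; this file] -/
theorem norm_couplingWeight_le_prod_exp_sub_one_mul_siteRatio_pow {β U μ : ℂ}
    (hz : atomicPartitionFn β U μ ≠ 0) (c : Bond Λ → ℂ) (K : Finset (Bond Λ)) :
    ‖couplingWeight β U μ c K‖ ≤
      (∏ b ∈ K, (Real.exp ‖c b‖ - 1)) * siteRatio β U μ ^ (cellSupp Bond.verts K).card := by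
  set A : Finset Λ := cellSupp Bond.verts K with hA
  -- the restricted couplings are supported inside `A`
  have hsupp : ∀ Y, Y ⊆ K → ∀ b, couplingRestrict c Y b ≠ 0 → b.1 ∈ A ∧ b.2.1 ∈ A := by
    intro Y hY b hb
    exact endpoints_mem_cellSupp (hY (mem_of_couplingRestrict_ne_zero hb))
  -- the complex diagonal `D = -βV_A`
  set d : Finset (Orb Λ) → ℂ := fun s => -onSiteDiag (β * U) (β * μ) A s with hd
  set Dm : Matrix (Finset (Orb Λ)) (Finset (Orb Λ)) ℂ := diagonal d with hDm
  have hD : -(β • onSiteSum U μ A) = Dm := neg_smul_onSiteSum_eq_diagonal_complex β U μ A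
  -- localisation of the normalised Gibbs factors to `A`
  have hloc : ∀ Y ∈ K.powerset, gibbsRatio β U μ (couplingRestrict c Y) =
      (NormedSpace.exp (Dm + hopSum (couplingRestrict c Y))).trace / (NormedSpace.exp Dm).trace := by
    intro Y hY
    rw [gibbsRatio_eq_div hz (hsupp Y (Finset.mem_powerset.1 hY)), hD]
  -- the Euler approximants of the alternating sum of local traces
  set ZR : ℝ := ∑ s, Real.exp ((d s).re) with hZR
  set S : ℂ := ∑ Y ∈ K.powerset, (-1 : ℂ) ^ (K \ Y).card *
    (NormedSpace.exp (Dm + hopSum (couplingRestrict c Y))).trace with hS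
  have hlim : Tendsto (fun N : ℕ => ∑ Y ∈ K.powerset, (-1 : ℂ) ^ (K \ Y).card *
      ((diagonal (fun s => Complex.exp (d s / N)) *
        (1 + (N : ℂ)⁻¹ • ∑ b ∈ Y, c b • bondOp b)) ^ N).trace) atTop (𝓝 S) := by
    refine tendsto_finsetSum _ fun Y _ => Tendsto.const_mul _ ?_
    rw [hopSum_couplingRestrict]
    refine (tendsto_trace_euler Dm _).congr fun N => ?_
    rw [hDm, exp_inv_smul_diagonal_complex]
  have hbound : ‖S‖ ≤ (∏ b ∈ K, (Real.exp ‖c b‖ - 1)) * ZR := by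
    refine le_of_tendsto hlim.norm ?_
    filter_upwards [eventually_ne_atTop 0] with N hN
    exact norm_alternatingSum_eulerTrace_le_complex hN d absEntry_bondOp_mem_subStoch c K
  -- the two traces of `e^{-βV_A}`: real parts and moduli
  have hZR' : ZR = atomicPartitionFnReal 1 (β * U).re (β * μ).re ^ A.card * 4 ^ (Fintype.card Λ - A.card) :=
    sum_exp_re_neg_onSiteDiag β U μ A
  have hZ : (NormedSpace.exp Dm).trace = atomicPartitionFn β U μ ^ A.card * 4 ^ (Fintype.card Λ - A.card) := by
    rw [← hD, trace_exp_neg_onSiteSum]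
  have hZn : ‖(NormedSpace.exp Dm).trace‖ = ‖atomicPartitionFn β U μ‖ ^ A.card * 4 ^ (Fintype.card Λ - A.card) := by
    rw [hZ, norm_mul, norm_pow, norm_pow]
    norm_num
  have hz' : 0 < ‖atomicPartitionFn β U μ‖ := norm_pos_iff.2 hz
  have hZpos : 0 < ‖(NormedSpace.exp Dm).trace‖ := by rw [hZn]; positivity
  -- `couplingWeight = S / Tr e^{-βV_A}`
  have hcw : couplingWeight β U μ c K = S / (NormedSpace.exp Dm).trace := by
    rw [couplingWeight_eq_sum, hS, Finset.sum_div]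
    refine Finset.sum_congr rfl fun Y hY => ?_
    rw [hloc Y hY, mul_div_assoc]
  rw [hcw, norm_div, div_le_iff₀ hZpos]
  have hP : 0 ≤ ∏ b ∈ K, (Real.exp ‖c b‖ - 1) :=
    Finset.prod_nonneg fun b _ => sub_nonneg.2 (Real.one_le_exp (norm_nonneg _))
  calc ‖S‖ ≤ (∏ b ∈ K, (Real.exp ‖c b‖ - 1)) * ZR := hbound
    _ = (∏ b ∈ K, (Real.exp ‖c b‖ - 1)) * siteRatio β U μ ^ A.card * ‖(NormedSpace.exp Dm).trace‖ := by
        rw [hZR', hZn, siteRatio, div_pow, mul_assoc]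
        congr 1
        rw [← mul_assoc, div_mul_cancel₀ _ (pow_ne_zero _ hz'.ne')]

/-! ### One-site Kotecký–Preiss smallness with the site ratio -/

variable {D : Finset (Bond Λ)}

/-- **THEOREM (one-site KP smallness of coupling-function activities at complex fugacity, Catalan ×
Hölder form with the site ratio).** For complex `β, U, μ` with `z₀ ≠ 0`, `r = siteRatio β U μ`,
`|c_b| ≤ δ_b` on `D`, weighted degree `Σ_{b ∈ D, v ∈ b} (e^{δ_b} - 1) ≤ W` at every site, `a ≥ 0` and
`r e^{a} + W F² ≤ F`: for every site `x` and finite family `𝒜` of site sets through `x`,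
`Σ_{A ∈ 𝒜} |couplingActivity D c A| e^{a|A|} ≤ F - r e^{a}`. The complex-fugacity sibling of #198.4's
`sum_norm_couplingActivity_mul_exp_le_catalan_exp` (there `r = 1`).
[folklore: KoteckyPreiss1986 condition (1) via the tree-graph bound; Ueltschi1999 §3; bounds.tex
§13 Lemma 13.1 (b),(e)] -/
theorem sum_norm_couplingActivity_mul_exp_le_catalan_exp_siteRatio {β U μ : ℂ}
    (hz : atomicPartitionFn β U μ ≠ 0) {δ : Bond Λ → ℝ} {c : Bond Λ → ℂ} (hc : ∀ b ∈ D, ‖c b‖ ≤ δ b)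
    {a W F : ℝ} (ha : 0 ≤ a)
    (hW : ∀ v : Λ, ∑ b ∈ D.filter (fun b => v ∈ Bond.verts b), (Real.exp (δ b) - 1) ≤ W)
    (hF : siteRatio β U μ * Real.exp a + W * F ^ 2 ≤ F) (x : Λ) (𝒜 : Finset (Finset Λ))
    (h𝒜 : ∀ A ∈ 𝒜, x ∈ A) :
    ∑ A ∈ 𝒜, ‖couplingActivity D β U μ c A‖ * Real.exp (a * A.card) ≤
      F - siteRatio β U μ * Real.exp a := by
  classical
  set r := siteRatio β U μ with hr
  have hr1 : 1 ≤ r := one_le_siteRatio hz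
  have hr0 : 0 < r := lt_of_lt_of_le one_pos hr1
  -- the shifted site weight `a' = a + log r ≥ a ≥ 0`, `e^{a'} = r e^{a}`
  set a' := a + Real.log r with ha'
  have ha'0 : 0 ≤ a' := add_nonneg ha (Real.log_nonneg hr1)
  have hexp' : Real.exp a' = r * Real.exp a := by
    rw [ha', Real.exp_add, Real.exp_log hr0, mul_comm]
  have hF' : Real.exp a' + W * F ^ 2 ≤ F := by rw [hexp']; exact hF
  set CC := connectedCellSets Bond.verts D with hCC
  set f : Finset (Bond Λ) → ℝ := fun X =>
    ‖couplingWeight β U μ c X‖ * Real.exp (a * ((cellSupp Bond.verts X).card : ℝ)) with hf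
  have hf0 : ∀ X, 0 ≤ f X := fun X => by positivity
  set Sx := CC.filter fun X => x ∈ cellSupp Bond.verts X with hSx
  -- Step a: bound by a sum over connected bond sets through `x` (verbatim from #195.3 / #198.4)
  have stepA : ∑ A ∈ 𝒜, ‖couplingActivity D β U μ c A‖ * Real.exp (a * A.card) ≤ ∑ X ∈ Sx, f X := by
    have h1 : ∀ A ∈ 𝒜, ‖couplingActivity D β U μ c A‖ * Real.exp (a * A.card) ≤
        ∑ X ∈ CC.filter (fun X => cellSupp Bond.verts X = A), f X := by
      intro A _
      rw [couplingActivity_apply, ← hCC]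
      refine (mul_le_mul_of_nonneg_right (norm_sum_le _ _) (Real.exp_nonneg _)).trans ?_
      rw [Finset.sum_mul]
      refine Finset.sum_le_sum fun X hX => le_of_eq ?_
      simp only [hf]
      rw [(Finset.mem_filter.1 hX).2]
    refine (Finset.sum_le_sum h1).trans ?_
    rw [← Finset.sum_biUnion]
    · refine Finset.sum_le_sum_of_subset_of_nonneg ?_ fun X _ _ => hf0 X
      intro X hX
      obtain ⟨A, hA, hXA⟩ := Finset.mem_biUnion.1 hX
      obtain ⟨hXCC, hXsupp⟩ := Finset.mem_filter.1 hXA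
      exact Finset.mem_filter.2 ⟨hXCC, hXsupp ▸ h𝒜 A hA⟩
    · intro A hA B hB hAB
      refine Finset.disjoint_left.2 fun X hXA hXB => hAB ?_
      rw [← (Finset.mem_filter.1 hXA).2, ← (Finset.mem_filter.1 hXB).2]
  -- Step b: each term is at most the tree-graph weight with `w_b = e^{δ_b} - 1` and site weight `e^{a'}`
  set w : Bond Λ → ℝ := fun b => Real.exp (δ b) - 1 with hw
  have hw0 : ∀ b ∈ D, 0 ≤ w b := fun b hb => by
    have : 0 ≤ δ b := (norm_nonneg _).trans (hc b hb)
    simp only [hw, sub_nonneg]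
    exact Real.one_le_exp this
  have stepB : ∀ X ∈ Sx, f X ≤ (∏ b ∈ X, w b) * Real.exp (a' * ((cellSupp Bond.verts X).card : ℝ)) := by
    intro X hX
    have hXD : X ⊆ D := (mem_connectedCellSets.1 (Finset.mem_filter.1 hX).1).1
    have hb := norm_couplingWeight_le_prod_exp_sub_one_mul_siteRatio_pow hz c X
    have hP : (∏ b ∈ X, (Real.exp ‖c b‖ - 1)) ≤ ∏ b ∈ X, w b := by
      refine Finset.prod_le_prod (fun b _ => sub_nonneg.2 (Real.one_le_exp (norm_nonneg _))) ?_
      intro b hb'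
      simp only [hw, sub_le_sub_iff_right, Real.exp_le_exp]
      exact hc b (hXD hb')
    have hwX : 0 ≤ ∏ b ∈ X, w b := Finset.prod_nonneg fun b hb' => hw0 b (hXD hb')
    have hea : Real.exp (a' * ((cellSupp Bond.verts X).card : ℝ)) =
        r ^ (cellSupp Bond.verts X).card * Real.exp (a * ((cellSupp Bond.verts X).card : ℝ)) := by
      rw [ha', add_mul, Real.exp_add, mul_comm (Real.log r), Real.exp_nat_mul, Real.exp_log hr0, mul_comm]
    calc f X = ‖couplingWeight β U μ c X‖ * Real.exp (a * ((cellSupp Bond.verts X).card : ℝ)) := rfl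
      _ ≤ (∏ b ∈ X, (Real.exp ‖c b‖ - 1)) * r ^ (cellSupp Bond.verts X).card *
            Real.exp (a * ((cellSupp Bond.verts X).card : ℝ)) :=
          mul_le_mul_of_nonneg_right hb (Real.exp_nonneg _)
      _ ≤ (∏ b ∈ X, w b) * r ^ (cellSupp Bond.verts X).card *
            Real.exp (a * ((cellSupp Bond.verts X).card : ℝ)) := by gcongr
      _ = (∏ b ∈ X, w b) * Real.exp (a' * ((cellSupp Bond.verts X).card : ℝ)) := by
          rw [hea, mul_assoc]
  -- Step c: the Catalan entropy bound (#195.2) at site weight `e^{a'}`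
  calc ∑ A ∈ 𝒜, ‖couplingActivity D β U μ c A‖ * Real.exp (a * A.card)
      ≤ ∑ X ∈ Sx, f X := stepA
    _ ≤ ∑ X ∈ Sx, (∏ b ∈ X, w b) * Real.exp (a' * ((cellSupp Bond.verts X).card : ℝ)) :=
        Finset.sum_le_sum stepB
    _ ≤ F - Real.exp a' := sum_prod_mul_exp_card_cellSupp_le hw0 ha'0 hW hF' x
    _ = F - siteRatio β U μ * Real.exp a := by rw [hexp']

end Hubbard

end Summit.HubbardSuperconductivity.HubbardLadder.Bounds
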